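import Summits.BirchSwinnertonDyer.BirchSwinnertonDyer.Theorems.GenusKolyvaginAtTwoGenusPrimitiveSupplyAtTwoPosDiscShallowArchimedeanBit
import Summits.BirchSwinnertonDyer.BirchSwinnertonDyer.Theorems.GenusKolyvaginAtTwoGenusPrimitiveSupplyAtTwoArchimedeanUnramifiedFrame
import HarnessLib

/-!
# Route `GenusKolyvaginAtTwo`, crux 25504 (Δ>0 supply), `#Sel₂(E) = 4` cell: THE TWIN IS STRICT AT `∞` AND DOES NOT MEET THE EGG —
# the archimedean instrument on the K₄⁺ cell (I2⁺), UNCONDITIONAL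

Seat `bsd-line-gk2-p5` g34 (cell `bsd-f1-sign2`, WIDTH-5 attach), `--supports stmt-BirchSwinnertonDyer-25504 --as helper`.  THEOREMS ONLY (no
definition, no named fact, no `sorry`); UNCONDITIONAL.  **BSD is NOT proved by this file and no item is closed by it.**

Companion of `ArchBit.meetsEgg_twist_of_selmerTrivial_allSilent` (p764697; `#Sel₂(E) = 1`: the twist MEETS the egg) and the Δ<0 pair
p763895 / `…TwinStrictOnFour` (the twin's strictness at the twisting prime reads `#Sel₂(E)`): on the Δ>0 real-narrow cell with `#Sel₂(E) = 4`
(the K₄⁺ cell of the supply crux) and an all-silent `2`-Selmer-minimal twin with `2` split, Mazur–Rubin Cor. 3.4 (i), NON-STRICT direction with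
`T = {∞}`, run for the pair `(Wd, W)` (gk2-p4's master datum backwards; gk2-p3 g18's archimedean engine
`GenusKolyArch.natCard_selmerGroup_mul_eq_of_transverse_inl_of_localization_ne_zero`): a class of `Sel₂(Wd)` non-trivial at `∞` would force
`#Sel₂(W)·2 = #Sel₂(Wd) = 2`.

* §1 `natCard_selmerGroup_mul_two_eq_of_twin_localization_real_ne_zero` (the engine backwards), `twin_selmer_localization_real_eq_zero_of_natCard_selmerGroup_eq_four`
  (**`#Sel₂(W) = 4`, `#Sel₂(Wd) = 2` ⟹ every class of `Sel₂(Wd)` is strict at `∞`**).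
* §2 **`not_meetsEgg_twist_of_natCard_selmerGroup_eq_four`** — on the frame (`y_K` of infinite order, `w = +1`, `rank W(ℚ) = 0`) the twist
  `W^(d_K)` has NO rational point on the egg: its generator (and every multiple, in particular the twin Heegner point) lies on the identity real
  component — the archimedean bit is identically «off the egg» on the K₄⁺ cell (calibration row I2⁺), in contrast with the K₁⁺ cell.

References: [MazurRubin2010] Lemma 2.9, Prop. 3.3, Cor. 3.4 (i); [Kramer1981] §2 Prop. 6, Thm. 1; [MilneADT2006] I Thm. 2.13, Thm. 4.10.
-/

set_option linter.dupNamespace false -- `Summit.<P>.<Sub>` repeats `BirchSwinnertonDyer` (D-0017)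
set_option autoImplicit false

noncomputable section

open scoped Classical ContRepresentation

namespace Summit.BirchSwinnertonDyer.BirchSwinnertonDyer.Theorems.GenusSupplyNarrow.ArchBit

open WeierstrassCurve Field NumberField IsDedekindDomain Function
open Literature.NumberTheory.EllipticCurves Literature.NumberTheory.GaloisRepresentations
open Literature.NumberTheory.GaloisRepresentations.DiscreteGaloisModule (SelmerStructure)
open Literature.NumberTheory.GaloisCohomology
open Summit.BirchSwinnertonDyer.Rank1Residual.X11b
open Summit.BirchSwinnertonDyer.Rank1Residual.X11b.CongruentTransfer
open Summit.BirchSwinnertonDyer.BirchSwinnertonDyer.Theorems.GenusKolyTwistLocal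
open Summit.BirchSwinnertonDyer.BirchSwinnertonDyer.Theorems.GenusExact.PlusDescent
open Summit.BirchSwinnertonDyer.BirchSwinnertonDyer.Theorems.GenusKolyArch
open Summit.BirchSwinnertonDyer.BirchSwinnertonDyer.Theorems.SchneiderFreeAdditiveX3.PoitouTateReduction
  (poitouTate_selmerStructure_duality_real_holds)
open Rat.HeightOneSpectrum (primesEquiv natGenerator)

variable (W : WeierstrassCurve ℚ) [W.IsElliptic] [W.IsGloballyMinimal]

/-! ## §1 A class of the twin non-trivial at `∞` halves `#Sel₂` downwards -/

/-- **Mazur–Rubin Cor. 3.4 (i), NON-STRICT direction with `T = {∞}`, for the pair `(Wd, W)` — UNCONDITIONAL.**  `W/ℚ` globally minimal with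
`Δ_W > 0` and `C(W)` odd; `K` imaginary quadratic with odd `d_K`, Heegner for `N_W`, `2` split; `Wd = Cd • W^(d_K)` elliptic and all-silent
(`ord₂ C(Wd) = 0`).  IF some class of `Sel₂(Wd)` localises non-trivially at `∞`, THEN `#Sel₂(W)·2 = #Sel₂(Wd)`.  (Split / good–good / silent–silent
agreement at every finite place via `menu₃_finite_rat_of_allSilent_of_two_split` transported along `φ′`; Lemma 2.9 transversality at `∞` from the
master datum, transported; `#𝓛_∞(Wd) = 2` since `Δ_{Wd} > 0`.)  [cite: MazurRubin2010, Lemma 2.9, Prop. 3.3, Cor. 3.4 (i)] [cite: Kramer1981, §2 Prop. 6] -/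
theorem natCard_selmerGroup_mul_two_eq_of_twin_localization_real_ne_zero {K : Type} [Field K] [NumberField K]
    (hpos : 0 < W.Δ) (hK : IsImaginaryQuadratic K) (hodd : Odd (discr K)) (hH : SatisfiesHeegnerHypothesis (W.conductorNorm ℤ) K)
    (h2K : ((Ideal.span {(2 : ℤ)}).primesOver (𝓞 K)).ncard = 2) (hTam : Odd W.tamagawaProduct)
    {Wd : WeierstrassCurve ℚ} [Wd.IsElliptic] (Cd : VariableChange ℚ) (hCd : Cd • W.quadraticTwist (discr K : ℚ) = Wd)
    (hDEF : padicValNat 2 Wd.tamagawaProduct = 0)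
    (hns : ∃ c ∈ (Wd.kummerSelmerStructure ((2 : ℕ) : ℤ)).selmerGroup,
      galoisCohomology.localization (Wd.torsionGaloisModule ((2 : ℕ) : ℤ)) (Sum.inl Rat.infinitePlace) 1 c ≠ 0) :
    Nat.card (W.selmerGroup ((2 : ℕ) : ℤ)) * 2 = Nat.card (Wd.selmerGroup ((2 : ℕ) : ℤ)) := by
  haveI : Fact (Nat.Prime 2) := ⟨Nat.prime_two⟩
  have hd0 : (discr K : ℚ) ≠ 0 := by exact_mod_cast NumberField.discr_ne_zero K
  have hdneg : (discr K : ℚ) < 0 := by exact_mod_cast IsImaginaryQuadratic.discr_neg hK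
  -- the real place, `Δ_W, Δ_{Wd} > 0` there, `d_K` not a real square
  have hw₀ : (Rat.infinitePlace).IsReal := Rat.isReal_infinitePlace
  have hΔ' : 0 < InfinitePlace.embedding_of_isReal hw₀ W.Δ := by rwa [embedding_of_isReal_rat_apply, Rat.cast_pos]
  have hΔd : 0 < Wd.Δ := by
    rw [← hCd, variableChange_Δ, quadraticTwist_Δ]
    have := (Cd.u⁻¹).ne_zero
    positivity
  have hΔd' : 0 < InfinitePlace.embedding_of_isReal hw₀ Wd.Δ := by rwa [embedding_of_isReal_rat_apply, Rat.cast_pos]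
  have hdsq₀ := forall_sq_ne_completion_of_neg hdneg Rat.infinitePlace
  -- Poitou–Tate and Tate's local Euler characteristic (tree theorems)
  have hPT := poitouTate_selmerStructure_duality_real_holds (K := ℚ)
  have hEP : ∀ v : HeightOneSpectrum (𝓞 ℚ), localEulerPoincareCharacteristic (v.adicCompletion ℚ) := fun v ↦
    haveI : CharZero (v.adicCompletion ℚ) := charZero_of_injective_algebraMap (algebraMap ℚ _).injective
    localEulerPoincareCharacteristic_holds (v.adicCompletion ℚ)
  -- the master datum for `(W, Wd)`, used backwards
  obtain ⟨φ, ψ, hψφ, hφψ, hsplit, -, -, hreal, -⟩ := exists_intertwining_master_frame W Wd hd0 hCd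
  have hundo : ∀ (v : Place ℚ) (X : AddSubgroup (galoisCohomology ((Wd.torsionGaloisModule ((2 : ℕ) : ℤ)).toLocal v) 1)),
      (X.map (galoisCohomology.map (φ.restrictField (Place.Completion v)) 1)).map
        (galoisCohomology.map (ψ.restrictField (Place.Completion v)) 1) = X := by
    intro v X
    rw [AddSubgroup.map_map]
    conv_rhs => rw [← AddSubgroup.map_id X]
    congr 1
    ext x
    exact map_restrictField_map_restrictField_of_comp_eq φ ψ hψφ v x
  let 𝓐 : SelmerStructure (Wd.torsionGaloisModule ((2 : ℕ) : ℤ)) := fun v ↦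
    (W.kummerSelmerStructure ((2 : ℕ) : ℤ) v).map (galoisCohomology.map (ψ.restrictField (Place.Completion v)) 1)
  have h𝓐 : ∀ v, 𝓐 v = (W.kummerSelmerStructure ((2 : ℕ) : ℤ) v).map
      (galoisCohomology.map (ψ.restrictField (Place.Completion v)) 1) := fun _ ↦ rfl
  have hsplit' : ∀ v : Place ℚ, (∃ s : Place.Completion v, s ^ 2 = algebraMap ℚ (Place.Completion v) (discr K : ℚ)) →
      𝓐 v = Wd.kummerSelmerStructure ((2 : ℕ) : ℤ) v := by
    intro v hs
    rw [h𝓐, kummerSelmerStructure_apply, kummerSelmerStructure_apply, ← hsplit (Place.Completion v) hs, hundo]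
  -- agreement at every finite place (three-row menu) — no infinite place other than `∞` over `ℚ`
  have hfin := menu₃_finite_rat_of_allSilent_of_two_split W hK hodd hH h2K hTam Cd hCd hDEF
  have hagree : ∀ v : Place ℚ, v ≠ Sum.inl Rat.infinitePlace → 𝓐 v = Wd.kummerSelmerStructure ((2 : ℕ) : ℤ) v := by
    rintro (w | v) hv
    · exact absurd (congrArg Sum.inl (Subsingleton.elim w Rat.infinitePlace)) hv
    · rcases hfin v with ⟨s, hs⟩ | ⟨h2v, hvWd, hvW⟩ | ⟨h2v, h1Wd, h1W⟩
      · exact hsplit' (Sum.inr v) ⟨s, hs⟩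
      · exact transport_kummer_inr_eq_of_good Wd W 2 ψ φ hψφ 𝓐 h𝓐 h2v hvWd hvW
      · rw [h𝓐, kummerSelmerStructure_apply, kummerSelmerStructure_apply]
        exact map_kummerLocalConditionAt_adicCompletion_eq_of_natCard_ker_eq_one Wd W v two_ne_zero h2v h1Wd h1W ψ
  -- transversality at `∞` (Lemma 2.9 for `(W, Wd)`), transported along `ψ`
  have htr' : 𝓐 (Sum.inl Rat.infinitePlace) ⊓ Wd.kummerSelmerStructure ((2 : ℕ) : ℤ) (Sum.inl Rat.infinitePlace) = ⊥ := by
    have h0 := hreal Rat.infinitePlace hw₀ hΔ' hdsq₀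
    rw [h𝓐, kummerSelmerStructure_apply, kummerSelmerStructure_apply, AddSubgroup.eq_bot_iff_forall]
    intro x hx
    obtain ⟨hx𝓐, hxWd⟩ := AddSubgroup.mem_inf.mp hx
    obtain ⟨y, hy, rfl⟩ := AddSubgroup.mem_map.mp hx𝓐
    have hφx : galoisCohomology.map (φ.restrictField (Place.Completion (Sum.inl Rat.infinitePlace : Place ℚ))) 1
        (galoisCohomology.map (ψ.restrictField (Place.Completion (Sum.inl Rat.infinitePlace : Place ℚ))) 1 y) = y :=
      map_restrictField_map_restrictField_of_comp_eq ψ φ hφψ (Sum.inl Rat.infinitePlace) y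
    have hmem : y ∈ (Wd.kummerLocalConditionAt ((2 : ℕ) : ℤ) (Rat.infinitePlace).Completion).map
          (galoisCohomology.map (φ.restrictField (Rat.infinitePlace).Completion) 1) ⊓
        W.kummerLocalConditionAt ((2 : ℕ) : ℤ) (Rat.infinitePlace).Completion :=
      AddSubgroup.mem_inf.mpr ⟨AddSubgroup.mem_map.mpr ⟨_, hxWd, hφx⟩, hy⟩
    rw [h0] at hmem
    have hy0 : y = 0 := AddSubgroup.mem_bot.mp hmem
    rw [hy0, map_zero]
  exact natCard_selmerGroup_mul_eq_of_transverse_inl_of_localization_ne_zero Wd W 2 hPT hEP ψ φ hφψ hψφ 𝓐 h𝓐 Rat.infinitePlace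
    hagree htr' (natCard_kummerSelmerStructure_inl_eq_two_of_isReal Wd hw₀ hΔd') hns

/-- **I2⁺, SELMER HALF: on the `#Sel₂(E) = 4` Δ>0 cell every `2`-Selmer class of the all-silent twin is STRICT AT `∞`** (frame of §1 with
`#Sel₂(W) = 4`, `#Sel₂(Wd) = 2`: a class non-trivial at `∞` would give `4·2 = 2`).  UNCONDITIONAL.  [cite: MazurRubin2010, Cor. 3.4 (i)] [cite: Kramer1981, §2 Prop. 6] -/
theorem twin_selmer_localization_real_eq_zero_of_natCard_selmerGroup_eq_four {K : Type} [Field K] [NumberField K]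
    (hpos : 0 < W.Δ) (hK : IsImaginaryQuadratic K) (hodd : Odd (discr K)) (hH : SatisfiesHeegnerHypothesis (W.conductorNorm ℤ) K)
    (h2K : ((Ideal.span {(2 : ℤ)}).primesOver (𝓞 K)).ncard = 2) (hTam : Odd W.tamagawaProduct)
    (h4 : Nat.card (W.selmerGroup 2) = 4)
    {Wd : WeierstrassCurve ℚ} [Wd.IsElliptic] (Cd : VariableChange ℚ) (hCd : Cd • W.quadraticTwist (discr K : ℚ) = Wd)
    (hDEF : padicValNat 2 Wd.tamagawaProduct = 0) (hSel : Nat.card (Wd.selmerGroup 2) = 2) :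
    ∀ c ∈ (Wd.kummerSelmerStructure ((2 : ℕ) : ℤ)).selmerGroup,
      galoisCohomology.localization (Wd.torsionGaloisModule ((2 : ℕ) : ℤ)) (Sum.inl Rat.infinitePlace) 1 c = 0 := by
  intro c hc
  by_contra hne
  have h := natCard_selmerGroup_mul_two_eq_of_twin_localization_real_ne_zero W hpos hK hodd hH h2K hTam Cd hCd hDEF ⟨c, hc, hne⟩
  simp only [Nat.cast_ofNat] at h
  rw [h4, hSel] at h
  omega

/-! ## §2 On the K₄⁺ cell the twist does NOT meet the egg -/

/-- **I2⁺ ON POINTS: on the `#Sel₂(E) = 4` Δ>0 cell the all-silent twist has NO rational point on the egg.**  `W/ℚ` globally minimal with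
`Δ_W > 0`, `ρ̄_{W,2}` onto, `C(W)` odd, `#Sel₂(W) = 4`, `rank W(ℚ) = 0`; `K` imaginary quadratic with odd `d_K`, Heegner for `N_W`, `2` split,
`τ ≠ 1`; a conductor-`1` frame `(Dt, β, ι, d₁)` with `y_K = P(1)` of infinite order and `2^(M+1) ∤ P(1)`, `w(W) = +1`; an elliptic
`Wd ≅ W^(d_K)` with `#Sel₂(Wd) = 2` and `ord₂ C(Wd) = 0`.  Then `¬ MeetsEgg (W^(d_K))`: every rational point of the twist — in particular its
generator and the twin Heegner point, WHATEVER `M₀` is — lies on the identity real component (`T(ℚ) ⊆ T⁰(ℝ) = 2T(ℝ)`).  (§1 for the model `T`;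
gk2-p5 g10's `exists_mem_selmerGroup_localization_inl_ne_zero_of_meetsEgg`.)  So on the K₄⁺ cell the archimedean bit is identically trivial (a
calibration row), exactly as the reduction bit at silent primes (p764232); the positive-depth content K₄⁺ has no depth-zero shadow.  UNCONDITIONAL.
[cite: Kramer1981, §2 Prop. 6 (p. 127)] [cite: MazurRubin2010, Prop. 3.3, Cor. 3.4 (i)] -/
theorem not_meetsEgg_twist_of_natCard_selmerGroup_eq_four {K : Type} [Field K] [NumberField K]
    (hpos : 0 < W.Δ) (hTam : Odd W.tamagawaProduct) (h4 : Nat.card (W.selmerGroup 2) = 4)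
    (hK : IsImaginaryQuadratic K) (hodd : Odd (discr K)) (hH : SatisfiesHeegnerHypothesis (W.conductorNorm ℤ) K)
    (h2K : ((Ideal.span {(2 : ℤ)}).primesOver (𝓞 K)).ncard = 2)
    {Wd : WeierstrassCurve ℚ} [Wd.IsElliptic] (Cd : VariableChange ℚ) (hCd : Cd • W.quadraticTwist (discr K : ℚ) = Wd)
    (hSel : Nat.card (Wd.selmerGroup 2) = 2) (hDEF : padicValNat 2 Wd.tamagawaProduct = 0) :
    haveI := W.isElliptic_quadraticTwist (show (discr K : ℚ) ≠ 0 by exact_mod_cast NumberField.discr_ne_zero K)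
    ¬ Summit.BirchSwinnertonDyer.Rank1Residual.F1Sign2.MeetsEgg (W.quadraticTwist (discr K : ℚ)) := by
  haveI : Fact (Nat.Prime 2) := ⟨Nat.prime_two⟩
  have hd0 : (discr K : ℚ) ≠ 0 := by exact_mod_cast NumberField.discr_ne_zero K
  haveI hTell : (W.quadraticTwist (discr K : ℚ)).IsElliptic := W.isElliptic_quadraticTwist hd0
  set T := W.quadraticTwist (discr K : ℚ) with hTdef
  -- the model `T = 1 • T`: same `2`-Selmer count and Tamagawa valuation as `Wd`
  have hSelT : Nat.card (T.selmerGroup 2) = 2 := by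
    have h := natCard_selmerGroup_smul T Cd (n := 2) two_ne_zero
    simp only [Nat.cast_ofNat] at h
    rw [← h, hCd, hSel]
  have hDEFT : padicValNat 2 T.tamagawaProduct = 0 := by
    have h1T := prod_ncard_roots_add_one_eq_two_pow_padicValNat_tamagawaProduct_twin W hK hodd hH hTam (Wd := T) 1 (one_smul _ _)
    have h2T := prod_ncard_roots_add_one_eq_two_pow_padicValNat_tamagawaProduct_twin W hK hodd hH hTam Cd hCd
    have heq : padicValNat 2 T.tamagawaProduct = padicValNat 2 Wd.tamagawaProduct :=
      Nat.pow_right_injective le_rfl (h1T.symm.trans h2T)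
    rw [heq, hDEF]
  intro hegg
  obtain ⟨c, hc, hne⟩ := exists_mem_selmerGroup_localization_inl_ne_zero_of_meetsEgg T hegg
  exact hne (twin_selmer_localization_real_eq_zero_of_natCard_selmerGroup_eq_four W hpos hK hodd hH h2K hTam h4 1 (one_smul _ _)
    hDEFT hSelT c hc)

end Summit.BirchSwinnertonDyer.BirchSwinnertonDyer.Theorems.GenusSupplyNarrow.ArchBit

end
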